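import Mathlib
import Summits.PneNP.PneNP.Theorems.ConvexRankGatesConvexGateBlindColorings

/-!
# PneNP / ConvexRankGates — `ConvexGateBlind`: the AND-of-thresholds (`dim Y = 0`) corner, one gate

Helpers (`--supports stmt-PneNP-10680`) toward the crux `ConvexGateBlind` of route `ConvexRankGates`.
A CONV gate of the route is `v ↦ [∃ Y ⪰ 0 (q × q), ∀ i < p, tr(Aᵢ Y) ≤ bᵢ + ∑ⱼ Bᵢⱼ [vⱼ]]`, `B ≥ 0`,
`p + q ≤ s`; its `q = 0` slice is exactly the class `ThrAnd_s` of ANDs of `≤ s` non-negative real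
threshold tests (`conv_dimZero_subset_thresholdAnd`, `thresholdAnd_subset_conv`), containing `∧₂`, `∨₂`.
* `pow_le_mul_of_thresholdAnd_separates`: an AND of `p` non-negative thresholds accepting all `k`-clique
  vectors and rejecting all `(k-1)`-colouring vectors has `(k-1)^m ≤ p · k² (m/k+1)^{k²} (k-1)^{m-m/k+k²}`
  (union bound over rejecting rows + `card_colorings_sum_lt_le`).
* `not_computes_cliqueFn_of_thresholdAnd`: so one gate over `{∧₂, ∨₂} ∪ ThrAnd_s` does not compute
  `CLIQUE(m, k)` (`k ≥ 3`) once `s · k² (m/k+1)^{k²} (k-1)^{m-m/k+k²} < (k-1)^m`.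
* `convexGateBlind_thresholdAnd_corner`: the crux's statement with CONV cut down to `dim Y = 0` and the
  size bound cut down to one gate, `δ = 1/4`, CLIQUE written inline as in the route file (uses `k³ ≪ m`).
This is the degenerate corner only (no LP variables, no alternation), recorded because the per-certificate
count on COLOURING negatives is the first ingredient of the intended method.
-/

namespace Summit.PneNP.PneNP.Theorems

open Finset Filter Literature.Computability.Complexity

/-! ### ANDs of non-negative thresholds cannot separate cliques from colourings cheaply -/

/-- **Union bound over rejecting rows.** If `p` non-negative threshold rows `0 ≤ bᵢ + ∑ₑ Bᵢₑ [xₑ]`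
all accept every `k`-clique vector (`k ≥ 2`) and every `(k-1)`-colouring vector violates some row, then
`(k-1)^m ≤ p · k² (m/k+1)^{k²} (k-1)^{m - m/k + k²}`: a violated row has `bᵢ < 0`, so `(Bᵢ, -bᵢ)` is a
certificate as in `card_colorings_sum_lt_le` and rejects at most that many colourings. [folklore] -/
theorem pow_le_mul_of_thresholdAnd_separates {m k p : ℕ} (hk : 2 ≤ k)
    (b : Fin p → ℝ) (B : Fin p → (⊤ : SimpleGraph (Fin m)).edgeSet → ℝ) (hB : ∀ i e, 0 ≤ B i e)
    (hpos : ∀ Q : Finset (Fin m), Q.card = k →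
      ∀ i, 0 ≤ b i + ∑ e, B i e * (if cliqueVec Q e then (1 : ℝ) else 0))
    (hneg : ∀ h : Fin m → Fin (k - 1),
      ∃ i, b i + ∑ e, B i e * (if colorVec h e then (1 : ℝ) else 0) < 0) :
    (k - 1) ^ m ≤ p * (k ^ 2 * (m / k + 1) ^ (k ^ 2) * (k - 1) ^ (m - m / k + k ^ 2)) := by
  classical
  set bound := k ^ 2 * (m / k + 1) ^ (k ^ 2) * (k - 1) ^ (m - m / k + k ^ 2) with hbound
  have hsum_eq : ∀ (i : Fin p) (x : (⊤ : SimpleGraph (Fin m)).edgeSet → Bool),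
      (∑ e, B i e * (if x e then (1 : ℝ) else 0)) = ∑ e, if x e = true then B i e else 0 := by
    intro i x
    refine Finset.sum_congr rfl fun e _ => ?_
    split_ifs <;> simp
  have hbad : ∀ i : Fin p, (univ.filter fun h : Fin m → Fin (k - 1) =>
      (∑ e, if colorVec h e = true then B i e else 0) < -b i).card ≤ bound := by
    intro i
    by_cases hb : 0 ≤ b i
    · have hempty : (univ.filter fun h : Fin m → Fin (k - 1) =>
          (∑ e, if colorVec h e = true then B i e else 0) < -b i) = ∅ := by
        refine Finset.filter_eq_empty_iff.2 fun h _ => not_lt.2 ?_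
        have h0 : 0 ≤ ∑ e, if colorVec h e = true then B i e else 0 :=
          Finset.sum_nonneg fun e _ => by
            split_ifs
            · exact hB i e
            · exact le_rfl
        linarith
      rw [hempty, Finset.card_empty]
      exact Nat.zero_le _
    · push Not at hb
      refine card_colorings_sum_lt_le hk (B i) (hB i) (θ := -b i) (by linarith) fun Q hQ => ?_
      have h1 := hpos Q hQ i
      rw [hsum_eq] at h1
      linarith
  have cover : (univ : Finset (Fin m → Fin (k - 1))) ⊆ (univ : Finset (Fin p)).biUnion fun i =>
      univ.filter fun h : Fin m → Fin (k - 1) =>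
        (∑ e, if colorVec h e = true then B i e else 0) < -b i := by
    intro h _
    obtain ⟨i, hi⟩ := hneg h
    rw [hsum_eq] at hi
    exact Finset.mem_biUnion.2 ⟨i, Finset.mem_univ _,
      Finset.mem_filter.2 ⟨Finset.mem_univ _, by linarith⟩⟩
  calc (k - 1) ^ m = (univ : Finset (Fin m → Fin (k - 1))).card := by
        rw [Finset.card_univ, Fintype.card_fun, Fintype.card_fin, Fintype.card_fin]
    _ ≤ ((univ : Finset (Fin p)).biUnion fun i => univ.filter fun h : Fin m → Fin (k - 1) =>
          (∑ e, if colorVec h e = true then B i e else 0) < -b i).card := Finset.card_le_card cover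
    _ ≤ ∑ i, (univ.filter fun h : Fin m → Fin (k - 1) =>
          (∑ e, if colorVec h e = true then B i e else 0) < -b i).card := Finset.card_biUnion_le
    _ ≤ ∑ _i : Fin p, bound := Finset.sum_le_sum fun i _ => hbad i
    _ = p * bound := by rw [Finset.sum_const, Finset.card_univ, Fintype.card_fin, smul_eq_mul]

/-! ### The AND-of-thresholds gate class and the `dim Y = 0` slice of CONV -/

/-- `∧₂` is an AND-of-thresholds gate of size `1`: `v₀ ∧ v₁ ↔ 0 ≤ -2 + [v₀] + [v₁]`. [folklore] -/
theorem and_two_mem_thresholdAnd {s : ℕ} (hs : 1 ≤ s) :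
    GateFn.and 2 ∈ {g : GateFn | ∃ p : ℕ, p ≤ s ∧ ∃ (b : Fin p → ℝ) (B : Fin p → Fin g.1 → ℝ),
      (∀ i j, 0 ≤ B i j) ∧ ∀ v : Fin g.1 → Bool, g.2 v = true ↔
        ∀ i, 0 ≤ b i + ∑ j, B i j * (if v j then (1 : ℝ) else 0)} := by
  refine ⟨1, hs, fun _ => -2, fun _ _ => 1, fun _ _ => zero_le_one, ?_⟩
  show ∀ v : Fin 2 → Bool, decide (∀ i, v i = true) = true ↔
    ∀ i : Fin 1, (0 : ℝ) ≤ -2 + ∑ j, 1 * (if v j then (1 : ℝ) else 0)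
  intro v
  simp only [decide_eq_true_eq, Fin.forall_fin_one, Fin.forall_fin_two, Fin.sum_univ_two, one_mul]
  cases v 0 <;> cases v 1 <;> norm_num

/-- `∨₂` is an AND-of-thresholds gate of size `1`: `v₀ ∨ v₁ ↔ 0 ≤ -1 + [v₀] + [v₁]`. [folklore] -/
theorem or_two_mem_thresholdAnd {s : ℕ} (hs : 1 ≤ s) :
    GateFn.or 2 ∈ {g : GateFn | ∃ p : ℕ, p ≤ s ∧ ∃ (b : Fin p → ℝ) (B : Fin p → Fin g.1 → ℝ),
      (∀ i j, 0 ≤ B i j) ∧ ∀ v : Fin g.1 → Bool, g.2 v = true ↔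
        ∀ i, 0 ≤ b i + ∑ j, B i j * (if v j then (1 : ℝ) else 0)} := by
  refine ⟨1, hs, fun _ => -1, fun _ _ => 1, fun _ _ => zero_le_one, ?_⟩
  show ∀ v : Fin 2 → Bool, decide (∃ i, v i = true) = true ↔
    ∀ i : Fin 1, (0 : ℝ) ≤ -1 + ∑ j, 1 * (if v j then (1 : ℝ) else 0)
  intro v
  simp only [decide_eq_true_eq, Fin.forall_fin_one, Fin.exists_fin_two, Fin.sum_univ_two, one_mul]
  cases v 0 <;> cases v 1 <;> norm_num

/-- Every AND-of-thresholds gate of size `≤ s` is a CONV gate of the route with `dim Y = 0` (take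
`q = 0`, `A = 0`): the right-hand class is, verbatim, the `Conv s` inlined in the route's items. [folklore] -/
theorem thresholdAnd_subset_conv (s : ℕ) :
    {g : GateFn | ∃ p : ℕ, p ≤ s ∧ ∃ (b : Fin p → ℝ) (B : Fin p → Fin g.1 → ℝ),
      (∀ i j, 0 ≤ B i j) ∧ ∀ v : Fin g.1 → Bool, g.2 v = true ↔
        ∀ i, 0 ≤ b i + ∑ j, B i j * (if v j then (1 : ℝ) else 0)}
    ⊆ {g : GateFn | ∃ (p q : ℕ), p + q ≤ s ∧ ∃ (A : Fin p → Matrix (Fin q) (Fin q) ℝ) (b : Fin p → ℝ)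
      (B : Fin p → Fin g.1 → ℝ), (∀ i j, 0 ≤ B i j) ∧ ∀ v : Fin g.1 → Bool, g.2 v = true ↔
        ∃ Y : Matrix (Fin q) (Fin q) ℝ, Y.PosSemidef ∧
          ∀ i, (A i * Y).trace ≤ b i + ∑ j, B i j * (if v j then (1 : ℝ) else 0)} := by
  rintro g ⟨p, hp, b, B, hB, hiff⟩
  refine ⟨p, 0, by simpa using hp, fun _ => 0, b, B, hB, fun v => ?_⟩
  rw [hiff]
  constructor
  · intro h
    exact ⟨0, Matrix.PosSemidef.zero, fun i => by simpa using h i⟩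
  · rintro ⟨Y, -, hY⟩ i
    simpa using hY i

/-- Conversely, a CONV gate of the route with `dim Y = 0` (the `q = 0` instance of the inlined `Conv s`:
the only matrix variable is the empty matrix) is an AND of at most `s` non-negative thresholds; with
`thresholdAnd_subset_conv`, `ThrAnd_s` is exactly the `dim Y = 0` slice of the crux's gate class. [folklore] -/
theorem conv_dimZero_subset_thresholdAnd (s : ℕ) :
    {g : GateFn | ∃ p : ℕ, p + 0 ≤ s ∧ ∃ (A : Fin p → Matrix (Fin 0) (Fin 0) ℝ) (b : Fin p → ℝ)
      (B : Fin p → Fin g.1 → ℝ), (∀ i j, 0 ≤ B i j) ∧ ∀ v : Fin g.1 → Bool, g.2 v = true ↔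
        ∃ Y : Matrix (Fin 0) (Fin 0) ℝ, Y.PosSemidef ∧
          ∀ i, (A i * Y).trace ≤ b i + ∑ j, B i j * (if v j then (1 : ℝ) else 0)}
    ⊆ {g : GateFn | ∃ p : ℕ, p ≤ s ∧ ∃ (b : Fin p → ℝ) (B : Fin p → Fin g.1 → ℝ),
      (∀ i j, 0 ≤ B i j) ∧ ∀ v : Fin g.1 → Bool, g.2 v = true ↔
        ∀ i, 0 ≤ b i + ∑ j, B i j * (if v j then (1 : ℝ) else 0)} := by
  rintro g ⟨p, hp, A, b, B, hB, hiff⟩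
  refine ⟨p, by simpa using hp, b, B, hB, fun v => ?_⟩
  rw [hiff]
  constructor
  · rintro ⟨Y, -, hY⟩ i
    have h1 := hY i
    rwa [Matrix.trace, Fintype.sum_empty] at h1
  · intro h
    refine ⟨0, Matrix.PosSemidef.zero, fun i => ?_⟩
    rw [Matrix.trace, Fintype.sum_empty]
    exact h i

/-! ### One gate over `{∧₂, ∨₂} ∪ ThrAnd_s` does not compute CLIQUE -/

/-- **The one-gate, `dim Y = 0` corner of `ConvexGateBlind`, finite form.** If `k ≥ 3` and
`s · k² (m/k+1)^{k²} (k-1)^{m - m/k + k²} < (k-1)^m`, no circuit with at most one gate over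
`{∧₂, ∨₂} ∪ ThrAnd_s` computes `CLIQUE(m, k)`: a gate-free circuit outputs an input edge (refuted by a
colouring separating its ends); a one-gate circuit reads input wires only, so it is an AND of `≤ s`
thresholds in the edge variables, and `pow_le_mul_of_thresholdAnd_separates` applies. [folklore] -/
theorem not_computes_cliqueFn_of_thresholdAnd {m k s : ℕ} (hk : 3 ≤ k) (hs : 1 ≤ s)
    (hnum : s * (k ^ 2 * (m / k + 1) ^ (k ^ 2) * (k - 1) ^ (m - m / k + k ^ 2)) < (k - 1) ^ m)
    (C : Circuit ((⊤ : SimpleGraph (Fin m)).edgeSet))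
    (hC : C.IsOver ({GateFn.and 2, GateFn.or 2} ∪ {g : GateFn | ∃ p : ℕ, p ≤ s ∧
      ∃ (b : Fin p → ℝ) (B : Fin p → Fin g.1 → ℝ), (∀ i j, 0 ≤ B i j) ∧ ∀ v : Fin g.1 → Bool,
        g.2 v = true ↔ ∀ i, 0 ≤ b i + ∑ j, B i j * (if v j then (1 : ℝ) else 0)}))
    (hsize : C.size ≤ 1) : ¬ C.Computes (cliqueFn m k) := by
  classical
  intro hcomp
  have hk1 : k - 1 < k := by omega
  have hproj : ∀ e : (⊤ : SimpleGraph (Fin m)).edgeSet, (∀ x, C.eval x = x e) → False := by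
    intro e he
    obtain ⟨a, a', hab⟩ := sym2_exists_eq_mk (e : Sym2 (Fin m))
    have hne : a ≠ a' := by
      have hmem := e.2
      rw [hab, SimpleGraph.mem_edgeSet, SimpleGraph.top_adj] at hmem
      exact hmem
    let h : Fin m → Fin (k - 1) := fun v => if v = a then ⟨0, by omega⟩ else ⟨1, by omega⟩
    have h1 : colorVec h e = true := by
      simp only [colorVec, Bool.not_eq_true', decide_eq_false_iff_not]
      rw [hab, Sym2.map_mk, Sym2.mk_isDiag_iff]
      simp only [h, if_pos rfl, if_neg (Ne.symm hne)]
      exact fun heq => absurd (Fin.mk.inj_iff.1 heq) (by norm_num)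
    have h2 := hcomp (colorVec h)
    rw [he, h1, cliqueFn_colorVec h hk1] at h2
    exact Bool.noConfusion h2
  obtain ⟨gates, out, wf, wf_out⟩ := C
  rcases out with e | n
  · exact hproj e fun x => rfl
  · -- the output is gate `n`, so `n = 0` and there is exactly one gate `g`
    have hn : n < gates.length := wf_out n rfl
    have hlen : gates.length = 1 := by
      change gates.length ≤ 1 at hsize
      omega
    obtain ⟨g, rfl⟩ := List.length_eq_one_iff.1 hlen
    have hn0 : n = 0 := by simp at hn; omega
    subst hn0
    have hev : ∀ x : (⊤ : SimpleGraph (Fin m)).edgeSet → Bool,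
        Circuit.eval ⟨[g], Sum.inr 0, wf, wf_out⟩ x = g.op (fun a => Sum.elim x (fun _ => false) (g.args a)) := by
      intro x
      simp only [Circuit.eval, Circuit.wireVals, List.foldl_cons, List.foldl_nil, List.nil_append,
        List.getD_cons_zero]
      congr 1
      funext a
      cases g.args a <;> simp
    have hg : g.fn ∈ {g : GateFn | ∃ p : ℕ, p ≤ s ∧ ∃ (b : Fin p → ℝ) (B : Fin p → Fin g.1 → ℝ),
        (∀ i j, 0 ≤ B i j) ∧ ∀ v : Fin g.1 → Bool, g.2 v = true ↔
          ∀ i, 0 ≤ b i + ∑ j, B i j * (if v j then (1 : ℝ) else 0)} := by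
      have h1 := hC g (by simp)
      rcases h1 with h1 | h1
      · rcases h1 with h1 | h1
        · rw [h1]; exact and_two_mem_thresholdAnd hs
        · rw [Set.mem_singleton_iff.1 h1]; exact or_two_mem_thresholdAnd hs
      · exact h1
    obtain ⟨p, hp, b, B, hB, hiff⟩ := hg
    let B' : Fin p → (⊤ : SimpleGraph (Fin m)).edgeSet → ℝ :=
      fun i e => ∑ j ∈ univ.filter (fun j : Fin g.arity => g.args j = Sum.inl e), B i j
    have hB' : ∀ i e, 0 ≤ B' i e := fun i e => Finset.sum_nonneg fun j _ => hB i j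
    have hind : ∀ (x : (⊤ : SimpleGraph (Fin m)).edgeSet → Bool) (j : Fin g.arity),
        (if Sum.elim x (fun _ => false) (g.args j) then (1 : ℝ) else 0)
          = ∑ e, if g.args j = Sum.inl e then (if x e then (1 : ℝ) else 0) else 0 := by
      intro x j
      rcases hja : g.args j with e₀ | n₀
      · simp only [Sum.elim_inl, Sum.inl.injEq]
        rw [Finset.sum_ite_eq]
        simp
      · simp
    have hkey : ∀ (x : (⊤ : SimpleGraph (Fin m)).edgeSet → Bool) (i : Fin p),
        (∑ j, B i j * (if Sum.elim x (fun _ => false) (g.args j) then (1 : ℝ) else 0))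
          = ∑ e, B' i e * (if x e then (1 : ℝ) else 0) := by
      intro x i
      simp_rw [hind, Finset.mul_sum, B', Finset.sum_mul]
      rw [Finset.sum_comm]
      refine Finset.sum_congr rfl fun e _ => ?_
      rw [Finset.sum_filter]
      refine Finset.sum_congr rfl fun j _ => ?_
      split_ifs <;> simp
    have hpos : ∀ Q : Finset (Fin m), Q.card = k →
        ∀ i, 0 ≤ b i + ∑ e, B' i e * (if cliqueVec Q e then (1 : ℝ) else 0) := by
      intro Q hQ i
      have h1 := hcomp (cliqueVec Q)
      rw [hev, cliqueFn_cliqueVec hQ.ge] at h1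
      have h2 := (hiff _).1 h1 i
      rwa [hkey] at h2
    have hneg : ∀ h : Fin m → Fin (k - 1),
        ∃ i, b i + ∑ e, B' i e * (if colorVec h e then (1 : ℝ) else 0) < 0 := by
      intro h
      have h1 := hcomp (colorVec h)
      rw [hev, cliqueFn_colorVec h hk1] at h1
      have h2 : ¬ ∀ i, 0 ≤ b i + ∑ j, B i j *
          (if Sum.elim (colorVec h) (fun _ => false) (g.args j) then (1 : ℝ) else 0) := by
        intro hall
        have h3 := (hiff _).2 hall
        exact Bool.noConfusion (h3.symm.trans h1)
      push Not at h2
      obtain ⟨i, hi⟩ := h2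
      refine ⟨i, ?_⟩
      rwa [hkey] at hi
    have hle := pow_le_mul_of_thresholdAnd_separates (by omega) b B' hB' hpos hneg
    have hle' : p * (k ^ 2 * (m / k + 1) ^ (k ^ 2) * (k - 1) ^ (m - m / k + k ^ 2))
        ≤ s * (k ^ 2 * (m / k + 1) ^ (k ^ 2) * (k - 1) ^ (m - m / k + k ^ 2)) :=
      Nat.mul_le_mul_right _ hp
    omega

/-! ### Exponent bookkeeping for `k = ⌈m^{1/4}⌉₊` -/

/-- Pure arithmetic: if `k ≥ 3`, `m ≤ (k-1)^8`, `k² ≤ m`, `8 (c + 1 + 2k²) + 8 ≤ m/k` and `m ≥ 2` then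
`m^c · k² (m/k+1)^{k²} (k-1)^{m - m/k + k²} < (k-1)^m` (both sides over `(k-1)^{m - m/k}`: the left is
`≤ m^{c+1+2k²}`, the right is `(k-1)^{m/k} ≥ m^{c+2+2k²}`). [folklore] -/
theorem threshold_corner_numerics {m k c : ℕ} (hk : 3 ≤ k) (h8 : m ≤ (k - 1) ^ 8) (hk2 : k ^ 2 ≤ m)
    (hμ : 8 * (c + 1 + 2 * k ^ 2) + 8 ≤ m / k) (hm : 2 ≤ m) :
    m ^ c * (k ^ 2 * (m / k + 1) ^ (k ^ 2) * (k - 1) ^ (m - m / k + k ^ 2)) < (k - 1) ^ m := by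
  set μ := m / k with hμdef
  set E := c + 1 + 2 * k ^ 2 with hE
  have hμlt : μ < m := Nat.div_lt_self (by omega) (by omega)
  have hkk : k ≤ k ^ 2 := by nlinarith
  have hk1m : k - 1 ≤ m := by omega
  have h1 : m ^ c * (k ^ 2 * (μ + 1) ^ (k ^ 2) * (k - 1) ^ (k ^ 2)) ≤ m ^ E := by
    calc m ^ c * (k ^ 2 * (μ + 1) ^ (k ^ 2) * (k - 1) ^ (k ^ 2))
        ≤ m ^ c * (m * m ^ (k ^ 2) * m ^ (k ^ 2)) := by
          gcongr
          omega
      _ = m ^ E := by rw [hE]; ring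
  have h2 : m ^ E < (k - 1) ^ μ := by
    calc m ^ E < m ^ (E + 1) := Nat.pow_lt_pow_right (by omega) (by omega)
      _ ≤ ((k - 1) ^ 8) ^ (E + 1) := Nat.pow_le_pow_left h8 _
      _ = (k - 1) ^ (8 * (E + 1)) := by rw [← pow_mul]
      _ ≤ (k - 1) ^ μ := Nat.pow_le_pow_right (by omega) (by omega)
  have hμle : μ ≤ m := hμlt.le
  have hpos : 0 < (k - 1) ^ (m - μ) := Nat.pow_pos (by omega)
  calc m ^ c * (k ^ 2 * (μ + 1) ^ (k ^ 2) * (k - 1) ^ (m - μ + k ^ 2))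
      = m ^ c * (k ^ 2 * (μ + 1) ^ (k ^ 2) * (k - 1) ^ (k ^ 2)) * (k - 1) ^ (m - μ) := by
        rw [pow_add]; ring
    _ < (k - 1) ^ μ * (k - 1) ^ (m - μ) := Nat.mul_lt_mul_of_pos_right (h1.trans_lt h2) hpos
    _ = (k - 1) ^ m := by rw [← pow_add, Nat.add_sub_cancel' hμle]

/-- The side conditions of `threshold_corner_numerics` hold for `k = ⌈m^{1/4}⌉₊` and all large `m`
(namely `m ≥ (32 c + 256)^4`): with `x = m^{1/4}`, `x ≤ k < x + 1`, so `k - 1 ≥ x/2` gives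
`(k-1)^8 ≥ m²/256 ≥ m`, `k² ≤ 4x² ≤ x⁴ = m`, and `k · (8c + 16 + 16k²) ≤ (16c+32) x + 128 x³ ≤ x⁴ = m`. [folklore] -/
theorem eventually_threshold_corner_conditions (c : ℕ) : ∀ᶠ m : ℕ in atTop,
    3 ≤ ⌈(m : ℝ) ^ (1 / 4 : ℝ)⌉₊ ∧ m ≤ (⌈(m : ℝ) ^ (1 / 4 : ℝ)⌉₊ - 1) ^ 8 ∧
      ⌈(m : ℝ) ^ (1 / 4 : ℝ)⌉₊ ^ 2 ≤ m ∧
      8 * (c + 1 + 2 * ⌈(m : ℝ) ^ (1 / 4 : ℝ)⌉₊ ^ 2) + 8 ≤ m / ⌈(m : ℝ) ^ (1 / 4 : ℝ)⌉₊ ∧ 2 ≤ m := by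
  filter_upwards [eventually_ge_atTop ((32 * c + 256) ^ 4)] with m hm
  set x : ℝ := (m : ℝ) ^ (1 / 4 : ℝ) with hx
  set k : ℕ := ⌈x⌉₊ with hk
  have hx0 : 0 ≤ x := Real.rpow_nonneg (Nat.cast_nonneg m) _
  have hx4 : x ^ 4 = m := by
    rw [hx, ← Real.rpow_natCast, ← Real.rpow_mul (Nat.cast_nonneg m)]
    norm_num
  have hA : (32 * c + 256 : ℝ) ≤ x := by
    by_contra hcon
    push Not at hcon
    have h1 : x ^ 4 < (32 * c + 256 : ℝ) ^ 4 := by gcongr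
    have h2 : ((32 * c + 256) ^ 4 : ℕ) ≤ (m : ℝ) := by exact_mod_cast hm
    push_cast at h2
    linarith
  have hx256 : (256 : ℝ) ≤ x := by
    have hc0 : (0 : ℝ) ≤ c := Nat.cast_nonneg c
    linarith
  have hxk : x ≤ k := Nat.le_ceil x
  have hkx : (k : ℝ) < x + 1 := Nat.ceil_lt_add_one hx0
  have hk3 : 3 ≤ k := by
    have : (3 : ℝ) ≤ k := by linarith
    exact_mod_cast this
  have hk1 : ((k - 1 : ℕ) : ℝ) = (k : ℝ) - 1 := by
    rw [Nat.cast_sub (by omega)]; simp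
  have h8 : m ≤ (k - 1) ^ 8 := by
    have h1 : x / 2 ≤ ((k - 1 : ℕ) : ℝ) := by rw [hk1]; linarith
    have h2 : (x / 2) ^ 8 ≤ ((k - 1 : ℕ) : ℝ) ^ 8 := by gcongr
    have h3 : (m : ℝ) ≤ (x / 2) ^ 8 := by
      have h4 : (x / 2) ^ 8 = (m : ℝ) ^ 2 / 256 := by rw [div_pow, show (8 : ℕ) = 4 * 2 from rfl, pow_mul, hx4]; norm_num
      rw [h4]
      have hm256 : (256 : ℝ) ≤ m := by
        have : (256 : ℝ) ^ 4 ≤ x ^ 4 := by gcongr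
        rw [hx4] at this
        linarith [show (256:ℝ) ≤ 256 ^ 4 by norm_num]
      rw [le_div_iff₀ (by norm_num : (0:ℝ) < 256), sq]
      gcongr
    have : (m : ℝ) ≤ ((k - 1 : ℕ) : ℝ) ^ 8 := h3.trans h2
    exact_mod_cast this
  have hk2 : k ^ 2 ≤ m := by
    have h1 : (k : ℝ) ^ 2 ≤ (2 * x) ^ 2 := by gcongr; linarith
    have h2 : (2 * x) ^ 2 ≤ x ^ 4 := by
      have hx2 : (4 : ℝ) ≤ x ^ 2 := by nlinarith
      calc (2 * x) ^ 2 = 4 * x ^ 2 := by ring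
        _ ≤ x ^ 2 * x ^ 2 := by gcongr
        _ = x ^ 4 := by ring
    have : ((k ^ 2 : ℕ) : ℝ) ≤ m := by push_cast; rw [← hx4]; exact h1.trans h2
    exact_mod_cast this
  have hμ : 8 * (c + 1 + 2 * k ^ 2) + 8 ≤ m / k := by
    rw [Nat.le_div_iff_mul_le (by omega)]
    have h1 : ((8 * (c + 1 + 2 * k ^ 2) + 8) * k : ℝ) ≤ (16 * c + 32) * x + 128 * x ^ 3 := by
      have hk2x : (k : ℝ) ≤ 2 * x := by linarith
      have hk0 : (0 : ℝ) ≤ k := Nat.cast_nonneg k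
      calc ((8 * (c + 1 + 2 * k ^ 2) + 8) * k : ℝ) = (8 * c + 16) * k + 16 * k ^ 3 := by ring
        _ ≤ (8 * c + 16) * (2 * x) + 16 * (2 * x) ^ 3 := by gcongr
        _ = (16 * c + 32) * x + 128 * x ^ 3 := by ring
    have h2 : (16 * c + 32) * x + 128 * x ^ 3 ≤ x ^ 4 := by
      have h3 : 128 * x ^ 3 ≤ x ^ 4 / 2 := by nlinarith [pow_pos (by linarith : (0:ℝ) < x) 3]
      have h4 : (16 * c + 32) * x ≤ x ^ 4 / 2 := by
        have h5 : (32 * c + 64 : ℝ) ≤ x := by linarith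
        have h6 : x ≤ x ^ 3 := by nlinarith [pow_pos (by linarith : (0:ℝ) < x) 2]
        nlinarith
      linarith
    have : (((8 * (c + 1 + 2 * k ^ 2) + 8) * k : ℕ) : ℝ) ≤ m := by
      push_cast; rw [← hx4]; exact h1.trans h2
    exact_mod_cast this
  have hm2 : 2 ≤ m := by
    refine le_trans ?_ hm
    calc 2 ≤ 32 * c + 256 := by omega
      _ ≤ (32 * c + 256) ^ 4 := Nat.le_self_pow (by norm_num) _
  exact ⟨hk3, h8, hk2, hμ, hm2⟩

/-! ### The corner in the shape of the crux -/

open scoped Classical in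
/-- **`ConvexGateBlind`, `dim Y = 0` slice, one gate** (unconditional). There is `δ ∈ (0, 1/2)`
(namely `δ = 1/4`) such that for every `c`, for all large `m`, no circuit with at most one gate over
`{∧₂, ∨₂} ∪ ThrAnd_{m^c}` — `ThrAnd_s` = ANDs of at most `s` non-negative real threshold tests, which is
exactly the `dim Y = 0` slice of the route's `CONV_s` (`conv_dimZero_subset_thresholdAnd`,
`thresholdAnd_subset_conv`) — computes `CLIQUE(m, ⌈m^δ⌉₊)`, written inline as in the route file. The
crux itself allows `m^c` gates and SDP variables (`dim Y ≤ m^c`); this is its degenerate corner, proved by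
counting how few colouring negatives one non-negative certificate rejects. [folklore] -/
theorem convexGateBlind_thresholdAnd_corner :
    ∃ δ : ℝ, 0 < δ ∧ δ < 1 / 2 ∧ ∀ c : ℕ, ∀ᶠ m : ℕ in atTop,
      ∀ C : Circuit ((⊤ : SimpleGraph (Fin m)).edgeSet),
        C.IsOver ({GateFn.and 2, GateFn.or 2} ∪ {g : GateFn | ∃ p : ℕ, p ≤ m ^ c ∧
          ∃ (b : Fin p → ℝ) (B : Fin p → Fin g.1 → ℝ), (∀ i j, 0 ≤ B i j) ∧ ∀ v : Fin g.1 → Bool,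
            g.2 v = true ↔ ∀ i, 0 ≤ b i + ∑ j, B i j * (if v j then (1 : ℝ) else 0)}) →
        C.size ≤ 1 →
        ¬ C.Computes (fun x => decide (¬ (SimpleGraph.fromEdgeSet {e : Sym2 (Fin m) |
          ∃ h : e ∈ (⊤ : SimpleGraph (Fin m)).edgeSet, x ⟨e, h⟩ = true}).CliqueFree
            ⌈(m : ℝ) ^ δ⌉₊)) := by
  refine ⟨1 / 4, by norm_num, by norm_num, fun c => ?_⟩
  filter_upwards [eventually_threshold_corner_conditions c] with m hm C hC hsize
  obtain ⟨h3, h8, hk2, hμ, hm2⟩ := hm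
  have hs : 1 ≤ m ^ c := Nat.one_le_pow _ _ (by omega)
  exact not_computes_cliqueFn_of_thresholdAnd h3 hs (threshold_corner_numerics h3 h8 hk2 hμ hm2) C hC
    hsize

end Summit.PneNP.PneNP.Theorems
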